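import Mathlib
import HarnessLib
import Summits.AtomisticToContinuum.HydrodynamicLimit.Theses.OneFlightGossipEngine

/-!
# `KineticCurrentsWindowLDUniform` is the constant-family rung of `KineticCurrentsLDAlongFamilies`

Route `OneFlightGossipEngine`, sub-problem `HydrodynamicLimit`. The support item
stmt-AtomisticToContinuum-14662 (`KineticCurrentsWindowLDUniform`, the pointwise η₀-uniform
finite-kinetic-window LD bound for the restricted class of fast kinetic currents under local Gibbs
data) is, since the rev-21 route repair, the constant-family corollary of the docking node
stmt-AtomisticToContinuum-16659 (`KineticCurrentsLDAlongFamilies`: the same bound along jointly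
continuous one-parameter families of profiles and weights, thresholds uniform along the family,
window quantifier `∃ τ₀ ∀ τ ≥ τ₀`).

This file kernel-checks that corollary: given the family node with constant `η₀`, feed it the
constant families `s ↦ (a, θ₀, u₀)` and `s ↦ (A, b, G)` on the degenerate parameter interval
`[0, 0]` (joint continuity = continuity of the slice composed with the second projection), read its
conclusion at `τ := τ₀` and `s := 0`. Pure logic; no analysis. It supports the item without closing
it (the family node is the route's open crux).
-/

namespace Summit.AtomisticToContinuum.HydrodynamicLimit.Theorems

open MeasureTheory
open Summit.AtomisticToContinuum.HydrodynamicLimit.Theses.OneFlightGossipEngine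

/-- **The pointwise docking node from the family docking node.**
`KineticCurrentsLDAlongFamilies` (stmt-AtomisticToContinuum-16659) implies
`KineticCurrentsWindowLDUniform` (stmt-AtomisticToContinuum-14662) with the same `η₀`: constant
families over the parameter interval `[0, 0]`, `τ := τ₀`, `s := 0`. [folklore] -/
theorem kineticCurrentsWindowLDUniform_of_alongFamilies :
    KineticCurrentsLDAlongFamilies → KineticCurrentsWindowLDUniform := by
  rintro ⟨η₀, hη₀, hη⟩
  refine ⟨η₀, hη₀, ?_⟩
  intro a θ₀ u₀ ha hθ hu ha0 hθ0 σ hσ hguard Φ A b G hA hb hG hC h1 hv hE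
  -- the family node on the degenerate interval `[0, 0]` with constant families
  have key := hη 0 (fun _ => a) (fun _ => θ₀) (fun _ => u₀)
    (ha.comp continuous_snd) (hθ.comp continuous_snd) (hu.comp continuous_snd)
    (fun _ x => ha0 x) (fun _ x => hθ0 x) σ hσ (fun _ _ => hguard) Φ
    (fun _ => A) (fun _ => b) (fun _ => G)
    (hA.comp continuous_snd) (hb.comp continuous_snd) (hG.comp continuous_snd)
  obtain ⟨C, hC'⟩ := hC
  obtain ⟨β₀, hβ₀, hβ⟩ := key ⟨C, fun _ _ y => hC' y⟩ (fun _ _ x => h1 x) (fun _ _ x j => hv x j)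
    (fun _ _ x => hE x)
  refine ⟨β₀, hβ₀, ?_⟩
  intro β hββ ε hε
  obtain ⟨τ₀, hτ₀, hτ⟩ := hβ β hββ ε hε
  obtain ⟨N₀, hN⟩ := hτ τ₀ le_rfl
  exact ⟨τ₀, hτ₀, N₀, fun N hNN => hN N hNN 0 (Set.left_mem_Icc.mpr le_rfl)⟩

end Summit.AtomisticToContinuum.HydrodynamicLimit.Theorems
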